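import Literature.NumberTheory.EllipticCurves.ModularJacobianMultiplicityOneCosocleProofs
import Mathlib.RingTheory.Finiteness.Nakayama
import Mathlib.RingTheory.Artinian.Module
import Mathlib.LinearAlgebra.Dual.Lemmas
import HarnessLib

/-!
# `J₀(N)[𝔪] ≠ 0` and `H₁(X₀(N), ℤ) ≠ 𝔪 H₁(X₀(N), ℤ)` for every proper Hecke ideal `𝔪 ∋ ℓ`
# (the «`𝔪` is in the support» step of Mazur's multiplicity-one argument; Darmon–Diamond–Taylor §4.1 p. 108)

Topic `Literature/NumberTheory/EllipticCurves`, next to `ModularJacobianModPMultiplicityOne` (odd `ℓ`,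
`wiles1995_multiplicityOne`) and `ModularJacobianModTwoMultiplicityOne` (`ℓ = 2`,
`buzzard2000_multiplicityOne_gamma0`, Buzzard 2000 Prop. 2.4). THEOREMS ONLY: no definition, no named fact, no
`sorry`; nothing here asserts either multiplicity-one fact, and BSD is not touched.

WHAT IS PROVED (all unconditional, in the tree's analytic model `J0 N = S₂(Γ₀(N))^∨ ⧸ Λ`,
`Λ = periodHomologyHecke N = H₁(X₀(N), ℤ)`, `𝕋_ℤ = HeckeRing0 N 2 = ℤ[T_p : p prime]`):
* `HeckeRing0.eq_zero_of_forall_smul_periodHomologyHecke_eq_zero` — **`𝕋_ℤ` acts faithfully on `Λ`**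
  (Darmon–Diamond–Taylor §1.6 p. 41 «The ring `𝕋_ℤ` acts naturally on `Λ`»; faithfulness because `Λ` spans
  `S₂^∨` over `ℝ` — the tree's theorem `periodHomology_span_eq_top` — and `𝕋_ℤ ⊆ End S₂` acts on `S₂^∨` by
  transposition).
* `periodHomologyHecke_smul_top_ne_top` — **COSOCLE: `𝔪Λ ≠ Λ` for every proper ideal `𝔪` of `𝕋_ℤ`** (Nakayama
  + faithfulness).
* `Submodule.exists_ne_zero_forall_smul_eq_zero_of_smul_ne` — pure algebra: in a FINITE module, a submodule
  `P` with `I • P ≠ P` contains a non-zero element killed by `I` (Artinian induction + Nakayama; the finite-length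
  form of «the localization is non-zero, hence so is the `I`-torsion», Darmon–Diamond–Taylor p. 108).
* ★ `J0.exists_ne_zero_mem_torsionBySet` / `J0.nontrivial_torsionBySet` / `J0.finrank_torsionBySet_pos` —
  **SOCLE: `J₀(N)[𝔪] ≠ 0`, and `1 ≤ dim_{𝕋/𝔪} J₀(N)[𝔪]` for `𝔪` maximal**, for every proper ideal `𝔪` of `𝕋_ℤ`
  containing a non-zero integer `ℓ` (via `J₀(N)[ℓ] ≅ Λ/ℓΛ`, the tree's `J0.exists_linearDivMap`).

WHY (honesty). This is the step «`J(Γ)[m] ≠ 0` / `d ≥ 1`» that opens Mazur's multiplicity-one argument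
(Mazur 1977 §II.14; Darmon–Diamond–Taylor p. 108: «Since `𝕋_{K'}` acts faithfully on `S₂(Γ, K')`, the
localization `S₂(Γ, K')_𝔭` is non-zero, hence so is `S₂(Γ, K')[𝔭']`»; Buzzard's proof of Thm. 6.1 in the appendix to
Ribet–Stein: «`G⁰[m]` has dimension `d⁰ ≥ 1`»), carried out for the Jacobian's torsion in the tree's model. It is the
only step of the printed proof of `buzzard2000_multiplicityOne_gamma0` (Buzzard 2000 Prop. 2.4 ⟸ [E1] = Edixhoven 1992
Thm. 9.2 + (9.2.1), Lemma 2.3 ⟸ Ling–Oesterlé Prop. 6, Boston–Lenstra–Ribet; completed in Buzzard's appendix to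
Ribet–Stein, Thm. 6.1) that is statable in the tree today: the remaining content «`dim ≤ 2` and `dim` even» needs
`J₀(N)[𝔪]` as a `G_ℚ`-module (Eichler–Shimura relation, BLR), `J₀(N)/ℤ₂` and its finite flat `2`-torsion
(Fontaine, Gross §11–12 / Edixhoven §9) and the Shimura subgroup — none of which the analytic model `J0 N` carries.
It does NOT prove `buzzard2000_multiplicityOne_gamma0` (which stays a cited input), it proves `1 ≤ 2` of it; no summit
statement (BirchSwinnertonDyer) is proved by this file. Darmon–Diamond–Taylor p. 41: «it is not the case in general
that `Λ` is free of rank two over `𝕋_ℤ`» — the integral structure of `Λ` at `𝔪` is exactly what multiplicity one is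
about, and it is not decided by anything here.

## References

* H. Darmon, F. Diamond, R. Taylor, *Fermat's Last Theorem* (1995) [DarmonDiamondTaylor1995], §1.3 p. 27, §1.6 p. 41,
  §4.1 p. 108 (held text `paper:doi-10-4310-cdm-1995-v1995-n1-a1`, p0041 L6–7, p0108 L44).
* B. Mazur, *Modular curves and the Eisenstein ideal*, Publ. Math. IHÉS 47 (1977) §II.14 [Mazur1977].
* K. Buzzard, *On level-lowering for mod 2 representations*, Math. Res. Lett. 7 (2000) Prop. 2.4
  [Buzzard2000LevelLoweringModTwo]; K. Buzzard, Appendix to Ribet–Stein, *Lectures on Serre's conjectures*, Thm. 6.1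
  [RibetStein2008] (held text `paper:doi-10-1090-pcms-009-04`, p0085–p0086).
-/

set_option autoImplicit false

noncomputable section

open scoped MatrixGroups ModularForm

open Module Function CongruenceSubgroup

/-! ## §1 Algebra: a finite module whose `I`-cosocle on `P` is non-zero has non-zero `I`-socle in `P` -/

namespace Submodule

variable {R M : Type*} [CommRing R] [AddCommGroup M] [Module R M]

/-- **Non-zero cosocle ⇒ non-zero socle, in a finite module.** `M` a finite `R`-module (`R` commutative), `I` an
ideal, `P ⊆ M` a submodule with `I • P ≠ P`. Then some non-zero `x ∈ P` is killed by `I`. (Artinian induction on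
`P`: either `P' = I • P` again has `I • P' ≠ P'`, or `I • P' = P'` and Nakayama gives `r ≡ 1 (mod I)` killing `P'`,
whence `r • n ≠ 0` for some `n ∈ P` — else `P ⊆ P'` — and `I • (r • n) = r • (I • n) ⊆ r • P' = 0`.) The
finite-length form of «the localization at `𝔭` is non-zero, hence so is the `𝔭`-torsion `M[𝔭]`»
(Darmon–Diamond–Taylor §4.1, p. 108). [cite: DarmonDiamondTaylor1995, §4.1 (p. 108); algebra proved here] -/
theorem exists_ne_zero_forall_smul_eq_zero_of_smul_ne [Finite M] (I : Ideal R) (P : Submodule R M)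
    (hP : I • P ≠ P) : ∃ x ∈ P, x ≠ 0 ∧ ∀ t ∈ I, t • x = 0 := by
  haveI : IsArtinian R M := isArtinian_of_finite
  induction P using IsArtinian.induction with
  | hgt P ih =>
    have hlt : I • P < P := lt_of_le_of_ne Submodule.smul_le_right hP
    by_cases h' : I • (I • P) = I • P
    · -- Nakayama on the finite (hence finitely generated) submodule `P' = I • P`
      have hFG : (I • P).FG :=
        Submodule.fg_def.mpr ⟨(I • P : Submodule R M), Set.toFinite _, Submodule.span_eq _⟩
      obtain ⟨r, hr1, hr⟩ :=
        Submodule.exists_sub_one_mem_and_smul_eq_zero_of_fg_of_le_smul I (I • P) hFG h'.ge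
      -- some `n ∈ P` has `r • n ≠ 0`, else `P ⊆ I • P`
      obtain ⟨n, hn, hrn⟩ : ∃ n ∈ P, r • n ≠ 0 := by
        by_contra hall
        refine absurd (fun n hn ↦ ?_ : P ≤ I • P) (not_le_of_gt hlt)
        have h0 : r • n = 0 := by
          by_contra h
          exact hall ⟨n, hn, h⟩
        have h1 : n = r • n - (r - 1) • n := by rw [sub_smul, one_smul]; abel
        rw [h1, h0, zero_sub]
        exact Submodule.neg_mem _ (Submodule.smul_mem_smul hr1 hn)
      refine ⟨r • n, P.smul_mem r hn, hrn, fun t ht ↦ ?_⟩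
      rw [smul_smul, mul_comm, ← smul_smul]
      exact hr _ (Submodule.smul_mem_smul ht hn)
    · obtain ⟨x, hx, hx0, hxI⟩ := ih (I • P) hlt h'
      exact ⟨x, Submodule.smul_le_right hx, hx0, hxI⟩

end Submodule

namespace Literature.NumberTheory.EllipticCurves.ModularForms

variable (N : ℕ) [NeZero N]

/-! ## §2 `𝕋_ℤ` acts faithfully on `Λ = H₁(X₀(N), ℤ)` -/

/-- **`𝕋_ℤ` acts faithfully on the period homology `Λ = H₁(X₀(N), ℤ)`**: an element of
`𝕋_ℤ = ℤ[T_p] ⊆ End_ℂ S₂(Γ₀(N))` killing `Λ ⊆ S₂^∨` is zero. Its transpose kills the real span of `Λ`, which is all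
of `S₂^∨` (the tree's `periodHomology_span_eq_top`, Darmon–Diamond–Taylor §1.3 p. 27 «`Λ` is a lattice in `V`»),
and an endomorphism of the finite-dimensional `S₂` with zero transpose is zero. (Darmon–Diamond–Taylor §1.6 p. 41:
«The ring `𝕋_ℤ` acts naturally on `Λ`»; §4.1 p. 107: «`𝕋_R` acts faithfully on `S₂(Γ, R)`».)
[cite: DarmonDiamondTaylor1995, §1.3 (p. 27), §1.6 (p. 41), §4.1 (p. 107)] -/
theorem HeckeRing0.eq_zero_of_forall_smul_periodHomologyHecke_eq_zero (t : HeckeRing0 N 2)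
    (h : ∀ x : periodHomologyHecke N, t • x = 0) : t = 0 := by
  -- the transpose `t^∨` vanishes on `Λ`, hence on its real span `= ⊤`
  have hdual : ∀ φ : Module.Dual ℂ (CuspForm (Gamma0 N) 2), (HeckeRing0.toEnd N 2 t).dualMap φ = 0 := by
    let L : Module.Dual ℂ (CuspForm (Gamma0 N) 2) →ₗ[ℝ] Module.Dual ℂ (CuspForm (Gamma0 N) 2) :=
      (HeckeRing0.toEnd N 2 t).dualMap.restrictScalars ℝ
    have hle : Submodule.span ℝ (periodHomology N : Set (Module.Dual ℂ (CuspForm (Gamma0 N) 2))) ≤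
        LinearMap.ker L := by
      rw [Submodule.span_le]
      intro φ hφ
      have hx := h ⟨φ, (mem_periodHomologyHecke N).mpr hφ⟩
      have hx' : ((t • (⟨φ, (mem_periodHomologyHecke N).mpr hφ⟩ : periodHomologyHecke N) :
          periodHomologyHecke N) : Module.Dual ℂ (CuspForm (Gamma0 N) 2)) = 0 := by
        rw [hx]; rfl
      rw [Submodule.coe_smul] at hx'
      -- `t • φ = (toEnd t)^∨ φ` by definition of the dual action
      exact hx'
    rw [periodHomology_span_eq_top, top_le_iff] at hle
    intro φ
    have hφ : φ ∈ LinearMap.ker L := by rw [hle]; exact Submodule.mem_top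
    exact hφ
  -- hence `t = 0` on `S₂`, hence `t = 0`
  apply HeckeRing0.toEnd_injective N 2
  rw [map_zero]
  refine LinearMap.ext fun f ↦ ?_
  rw [LinearMap.zero_apply]
  refine (Module.forall_dual_apply_eq_zero_iff ℂ _).mp fun φ ↦ ?_
  have := hdual φ
  rw [LinearMap.ext_iff] at this
  simpa using this f

/-! ## §3 Cosocle: `𝔪Λ ≠ Λ` for a proper ideal `𝔪` -/

/-- `Λ = H₁(X₀(N), ℤ)` is a finitely generated `𝕋_ℤ`-module (it is already finitely generated over `ℤ`:
Darmon–Diamond–Taylor §1.3 p. 27, «a `ℤ`-module of rank `2g`»). [cite: DarmonDiamondTaylor1995, §1.3 (p. 27)] -/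
theorem moduleFinite_hecke_periodHomologyHecke : Module.Finite (HeckeRing0 N 2) (periodHomologyHecke N) := by
  haveI := moduleFinite_int_periodHomologyHecke N
  exact Module.Finite.of_restrictScalars_finite ℤ (HeckeRing0 N 2) (periodHomologyHecke N)

/-- **Cosocle non-vanishing: `𝔪 H₁(X₀(N), ℤ) ≠ H₁(X₀(N), ℤ)` for every proper ideal `𝔪` of `𝕋_ℤ`.** If
`𝔪Λ = Λ`, Nakayama gives `r ≡ 1 (mod 𝔪)` with `rΛ = 0`; faithfulness
(`HeckeRing0.eq_zero_of_forall_smul_periodHomologyHecke_eq_zero`) forces `r = 0`, so `1 ∈ 𝔪`. This is «`𝔪` lies in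
the support of `Λ`» (Darmon–Diamond–Taylor §4.1 p. 108, the faithful-action argument; §1.6 p. 41).
[cite: DarmonDiamondTaylor1995, §4.1 (p. 108), §1.6 (p. 41)] -/
theorem periodHomologyHecke_smul_top_ne_top {𝔪 : Ideal (HeckeRing0 N 2)} (h𝔪 : 𝔪 ≠ ⊤) :
    𝔪 • (⊤ : Submodule (HeckeRing0 N 2) (periodHomologyHecke N)) ≠ ⊤ := by
  intro heq
  haveI := moduleFinite_hecke_periodHomologyHecke N
  obtain ⟨r, hr1, hr⟩ := Submodule.exists_sub_one_mem_and_smul_eq_zero_of_fg_of_le_smul 𝔪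
    (⊤ : Submodule (HeckeRing0 N 2) (periodHomologyHecke N)) Module.Finite.fg_top heq.ge
  have hr0 : r = 0 :=
    HeckeRing0.eq_zero_of_forall_smul_periodHomologyHecke_eq_zero N r fun x ↦ hr x Submodule.mem_top
  rw [hr0, zero_sub] at hr1
  exact h𝔪 ((Ideal.eq_top_iff_one 𝔪).mpr (by simpa using 𝔪.neg_mem hr1))

/-- **`dim_{𝕋/𝔪} H₁(X₀(N), ℤ)/𝔪 ≥ 1`** for a maximal ideal `𝔪` of `𝕋_ℤ` (the cosocle form of the non-vanishing;
the quotient is a non-zero finitely generated `𝕋/𝔪`-vector space). [cite: DarmonDiamondTaylor1995, §4.1 (p. 108), §1.6 (p. 41)] -/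
theorem finrank_periodHomologyHecke_quotient_pos (𝔪 : Ideal (HeckeRing0 N 2)) [h𝔪 : 𝔪.IsMaximal] :
    0 < Module.finrank (HeckeRing0 N 2 ⧸ 𝔪)
      (periodHomologyHecke N ⧸ 𝔪 • (⊤ : Submodule (HeckeRing0 N 2) (periodHomologyHecke N))) := by
  letI : Field (HeckeRing0 N 2 ⧸ 𝔪) := Ideal.Quotient.field 𝔪
  haveI := moduleFinite_hecke_periodHomologyHecke N
  haveI : Module.Finite (HeckeRing0 N 2 ⧸ 𝔪)
      (periodHomologyHecke N ⧸ 𝔪 • (⊤ : Submodule (HeckeRing0 N 2) (periodHomologyHecke N))) :=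
    Module.Finite.of_restrictScalars_finite (HeckeRing0 N 2) _ _
  haveI : Nontrivial (periodHomologyHecke N ⧸ 𝔪 • (⊤ : Submodule (HeckeRing0 N 2) (periodHomologyHecke N))) :=
    Submodule.Quotient.nontrivial_iff.mpr (periodHomologyHecke_smul_top_ne_top N h𝔪.ne_top)
  exact Module.finrank_pos

/-! ## §4 Socle: `J₀(N)[𝔪] ≠ 0` -/

/-- **`J₀(N)[𝔪] ≠ 0`: for every proper ideal `𝔪` of `𝕋_ℤ` containing a non-zero integer `ℓ`, some non-zero point
of `J₀(N)(ℂ) = S₂^∨/Λ` is killed by `𝔪`.** Inside the finite `𝕋_ℤ`-module `J₀(N)[ℓ] ≅ Λ/ℓΛ` (the tree's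
`J0.exists_linearDivMap`, Darmon–Diamond–Taylor p. 134 «`T_ℓ J₀(N)/ℓ ≅ J₀(N)[ℓ]`») one has
`𝔪 · J₀(N)[ℓ] ≠ J₀(N)[ℓ]` (else `Λ = 𝔪Λ + ℓΛ = 𝔪Λ`, contradicting `periodHomologyHecke_smul_top_ne_top`), and a
finite module with non-zero `𝔪`-cosocle has non-zero `𝔪`-socle (§1). This is the step «`J[𝔪] ≠ 0`» of Mazur's
multiplicity-one argument (Mazur 1977 §II.14; Darmon–Diamond–Taylor p. 108; Buzzard, appendix to Ribet–Stein,
proof of Thm. 6.1: «`d⁰ ≥ 1`»). [cite: DarmonDiamondTaylor1995, §4.1 (p. 108) and §4.5 (p. 134)]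
[cite: Mazur1977, §II.14] -/
theorem J0.exists_ne_zero_mem_torsionBySet {𝔪 : Ideal (HeckeRing0 N 2)} (h𝔪 : 𝔪 ≠ ⊤) {ℓ : ℕ} (hℓ : ℓ ≠ 0)
    (hℓ𝔪 : (ℓ : HeckeRing0 N 2) ∈ 𝔪) :
    ∃ p ∈ Submodule.torsionBySet (HeckeRing0 N 2) (J0 N) 𝔪, p ≠ 0 := by
  obtain ⟨δ, -, hker, hrange⟩ := J0.exists_linearDivMap N hℓ
  haveI : Finite (Submodule.torsionBy (HeckeRing0 N 2) (J0 N) ℓ) := J0.finite_torsionBy N hℓ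
  -- `δ` lands in `T = J₀(N)[ℓ]`
  have hδT : ∀ x : periodHomologyHecke N, δ x ∈ Submodule.torsionBy (HeckeRing0 N 2) (J0 N) ℓ := by
    intro x
    rw [Submodule.mem_torsionBy_iff, Nat.cast_smul_eq_nsmul, ← map_nsmul]
    exact (hker (ℓ • x)).mpr ⟨x, rfl⟩
  -- every element of `𝔪 · T` lifts along `δ` to `𝔪Λ`
  have hlift : ∀ q : Submodule.torsionBy (HeckeRing0 N 2) (J0 N) ℓ,
      q ∈ 𝔪 • (⊤ : Submodule (HeckeRing0 N 2) (Submodule.torsionBy (HeckeRing0 N 2) (J0 N) ℓ)) →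
      ∃ y ∈ 𝔪 • (⊤ : Submodule (HeckeRing0 N 2) (periodHomologyHecke N)), δ y = (q : J0 N) := by
    intro q hq
    refine Submodule.smul_induction_on hq (fun t ht n _ ↦ ?_) (fun a b ha hb ↦ ?_)
    · obtain ⟨y₀, hy₀⟩ := hrange (n : J0 N) n.2
      refine ⟨t • y₀, Submodule.smul_mem_smul ht Submodule.mem_top, ?_⟩
      rw [map_smul, hy₀, Submodule.coe_smul]
    · obtain ⟨ya, hya, ha'⟩ := ha
      obtain ⟨yb, hyb, hb'⟩ := hb
      refine ⟨ya + yb, Submodule.add_mem _ hya hyb, ?_⟩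
      rw [map_add, ha', hb', Submodule.coe_add]
  -- `𝔪 · T ≠ T`, else `Λ = 𝔪Λ`
  have hne : 𝔪 • (⊤ : Submodule (HeckeRing0 N 2) (Submodule.torsionBy (HeckeRing0 N 2) (J0 N) ℓ)) ≠ ⊤ := by
    intro heq
    apply periodHomologyHecke_smul_top_ne_top N h𝔪
    refine eq_top_iff.mpr fun x _ ↦ ?_
    have hmem : (⟨δ x, hδT x⟩ : Submodule.torsionBy (HeckeRing0 N 2) (J0 N) ℓ) ∈
        𝔪 • (⊤ : Submodule (HeckeRing0 N 2) (Submodule.torsionBy (HeckeRing0 N 2) (J0 N) ℓ)) := by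
      rw [heq]; exact Submodule.mem_top
    obtain ⟨y, hy, hyx⟩ := hlift _ hmem
    have h0 : δ (x - y) = 0 := by rw [map_sub, sub_eq_zero]; exact hyx.symm
    obtain ⟨z, hz⟩ := (hker (x - y)).mp h0
    have hx : x = y + ℓ • z := sub_eq_iff_eq_add'.mp hz
    rw [hx]
    refine Submodule.add_mem _ hy ?_
    rw [← Nat.cast_smul_eq_nsmul (HeckeRing0 N 2)]
    exact Submodule.smul_mem_smul hℓ𝔪 Submodule.mem_top
  obtain ⟨x, -, hx0, hx𝔪⟩ := Submodule.exists_ne_zero_forall_smul_eq_zero_of_smul_ne 𝔪 ⊤ hne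
  refine ⟨(x : J0 N), ?_, fun h ↦ hx0 (Subtype.ext h)⟩
  rw [Submodule.mem_torsionBySet_iff]
  rintro ⟨a, ha⟩
  have h1 := congrArg Subtype.val (hx𝔪 a ha)
  rw [Submodule.coe_smul, Submodule.coe_zero] at h1
  exact h1

/-- **`J₀(N)[𝔪]` is non-trivial** for every proper ideal `𝔪 ∋ ℓ` (`ℓ ≠ 0`) of `𝕋_ℤ`
(`J0.exists_ne_zero_mem_torsionBySet`). [cite: DarmonDiamondTaylor1995, §4.1 (p. 108)] [cite: Mazur1977, §II.14] -/
theorem J0.nontrivial_torsionBySet {𝔪 : Ideal (HeckeRing0 N 2)} (h𝔪 : 𝔪 ≠ ⊤) {ℓ : ℕ} (hℓ : ℓ ≠ 0)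
    (hℓ𝔪 : (ℓ : HeckeRing0 N 2) ∈ 𝔪) :
    Nontrivial (Submodule.torsionBySet (HeckeRing0 N 2) (J0 N) 𝔪) := by
  obtain ⟨p, hp, hp0⟩ := J0.exists_ne_zero_mem_torsionBySet N h𝔪 hℓ hℓ𝔪
  exact ⟨⟨⟨p, hp⟩, 0, fun h ↦ hp0 (congrArg Subtype.val h)⟩⟩

/-- ★ **`dim_{𝕋/𝔪} J₀(N)[𝔪] ≥ 1`** for every maximal ideal `𝔪` of `𝕋_ℤ = ℤ[T_p] ⊆ End S₂(Γ₀(N))` containing a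
non-zero integer `ℓ` (in particular for every `𝔪 ∋ 2` of `buzzard2000_multiplicityOne_gamma0` and every `𝔪 ∋ ℓ` of
`wiles1995_multiplicityOne`, with NO hypothesis on `ρ_𝔪`): the lower bound `1 ≤ 2` of the printed multiplicity-one
conclusion `dim_{𝕋/𝔪} J₀(N)[𝔪] = 2` (Buzzard 2000 Prop. 2.4 / Def. 2.1; Darmon–Diamond–Taylor Thm. 4.26), i.e.
the step «`J[𝔪] ≠ 0`» of Mazur's argument, unconditionally in the tree's model. The printed `= 2` is NOT proved
here. [cite: DarmonDiamondTaylor1995, §4.1 (p. 108) and §4.5 (p. 134)] [cite: Mazur1977, §II.14]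
[cite: Buzzard2000LevelLoweringModTwo, Prop. 2.4 and Def. 2.1 (p. 100–101) — lower bound only] -/
theorem J0.finrank_torsionBySet_pos (𝔪 : Ideal (HeckeRing0 N 2)) [h𝔪 : 𝔪.IsMaximal] {ℓ : ℕ} (hℓ : ℓ ≠ 0)
    (hℓ𝔪 : (ℓ : HeckeRing0 N 2) ∈ 𝔪) :
    0 < Module.finrank (HeckeRing0 N 2 ⧸ 𝔪) (Submodule.torsionBySet (HeckeRing0 N 2) (J0 N) 𝔪) := by
  letI : Field (HeckeRing0 N 2 ⧸ 𝔪) := Ideal.Quotient.field 𝔪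
  haveI : Finite (Submodule.torsionBySet (HeckeRing0 N 2) (J0 N) 𝔪) := J0.finite_torsionBySet N hℓ hℓ𝔪
  haveI : Module.Finite (HeckeRing0 N 2 ⧸ 𝔪) (Submodule.torsionBySet (HeckeRing0 N 2) (J0 N) 𝔪) :=
    Module.Finite.of_finite
  haveI := J0.nontrivial_torsionBySet N h𝔪.ne_top hℓ hℓ𝔪
  exact Module.finrank_pos

/-- **The lower bound of Buzzard 2000 Prop. 2.4 as typed, unconditionally**: under (indeed without) the hypotheses of
`buzzard2000_multiplicityOne_gamma0` — `N ≥ 1`, `𝔪 ∋ 2` a maximal ideal of `𝕋_ℤ` — one has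
`1 ≤ dim_{𝕋/𝔪} J₀(N)[𝔪]` (`J0.finrank_torsionBySet_pos` at `ℓ = 2`). The printed statement asserts `= 2`; the
missing «`≤ 2` and even» is the arithmetic-geometric content (Edixhoven 1992 §9 / Buzzard's appendix Thm. 6.1,
Boston–Lenstra–Ribet, Ling–Oesterlé) that the analytic carrier `J0 N` cannot express. [cite: Buzzard2000LevelLoweringModTwo, Prop. 2.4 and Def. 2.1 (p. 100–101) — lower bound only]
[cite: DarmonDiamondTaylor1995, §4.1 (p. 108)] -/
theorem one_le_finrank_torsionBySet_J0_of_two_mem (𝔪 : Ideal (HeckeRing0 N 2)) [𝔪.IsMaximal]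
    (h2 : (2 : HeckeRing0 N 2) ∈ 𝔪) :
    1 ≤ Module.finrank (HeckeRing0 N 2 ⧸ 𝔪) (Submodule.torsionBySet (HeckeRing0 N 2) (J0 N) 𝔪) :=
  J0.finrank_torsionBySet_pos N 𝔪 (ℓ := 2) two_ne_zero (by exact_mod_cast h2)

end Literature.NumberTheory.EllipticCurves.ModularForms

end
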